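/-
Copyright (c) 2026 the pub-hodgecm-mathlib formalisation cell (harness21).  Prover seat hodgecm-mathlib-K2E3-p31 (g0), HCML Track B, programme R90-TF
(Rogawski 1990 trace formula), section S4 = Ch. 13.1–2 (base `R90-C131`, dealer K2E2-plan (g6), deal S4#C-CAN BY NAME 2026-09-04T16:34:04Z):
«CANONICAL ε-TWISTED ORBITAL MEASURES» on `G̃_v = GL₃(L ⊗ L⁺_v)` — the ε-twin of ★ `OrbitalMeasureFamily.IsCanonical`.  2026-09-04.
-/
import Summits.HodgeConjecture.HodgeConjecture.Theorems.R90S4TwistedTransferDefs      -- ★ (S4#C-TT): `IsEpsRegularAt`; brings ★ `Ch4Sec10` (`epsCentralizer`, `EpsConjClassesMod`, `EpsOrbitalMeasureFamily`), ★ `R90S4LocalBaseChangeDefs` (`GtLoc`, `epsLoc`)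
import Summits.HodgeConjecture.HodgeConjecture.Theorems.R90S4TwistLocalInvolution        -- ★ (K2E3-p27 g2): `continuous_unitaryTwist`, the involution `ε ∘ ε = 1` (cone context; `continuous_twistLocal` is ★ `K2E1GlobalTestFunctionsTwistedDefs`)
import Literature.NumberTheory.Automorphic.OrbitalMeasureCanonical                      -- ★ `compactCore`, `OrbitalMeasureFamily.IsCanonical` (the template), brings ★ `quotientMeasure`
import HarnessLib

/-!
# R90-TF · S4 «Ch. 13.1–2», support file S4#C-CAN: CANONICAL ε-TWISTED ORBITAL MEASURE FAMILIES ON `G̃_v` (Rogawski 1990, §1.6 pp. 5–6; §4.3 (4.3.1) p. 43; §4.10 (4.10.1) p. 57)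

Cell `hodgecm-mathlib`, crux H413 (`stmt-HodgeConjecture-24833`, lane `--supports … --as helper`, count-neutral); programme R90-TF, section S4 (dealer K2E2-plan (g6));
consumer: Lines C ED. 1 (Thm. 13.2.1 STEP ONE, Prop. 13.2.2) — «without it the lift sockets quantify over junk `mGt`» (dealer 16:34:04Z): the twisted orbital measure family
`mGt : EpsOrbitalMeasureFamily (epsLoc L Φ v) ⊥` entering `IsEpsTransferPair` ∕ `IsLocalEpsTransferExists` (★ S4#C-TT) must be PINNED to the invariant quotients of ONE Haar
measure `νGt` on `G̃_v` by normalised Haar measures on the ε-centralisers, exactly as ★ `OrbitalMeasureFamily.IsCanonical` pins the untwisted families.  ONE DEFINITION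
(S4-R5 «one home = Theorems») + two topological lemmas; no `instance`, no `notation`, no named-fact hypothesis, no `sorry`; ★-only imports; never imports `Lines`.

* §1 **`continuous_epsLoc`** — `ε_v = twistLocal L 3 Φ c v` is continuous (★ `continuous_twistLocal`).
* §1 **`isClosed_epsCentralizer`** — the ε-centraliser `G̃_{δε} = {g | δ⁻¹ g δ = ε(g)}` (★ `Ch4Sec10.epsCentralizer = MonoidHom.eqLocus (conj δ⁻¹) ε`) is CLOSED in `G̃_v`
  (equaliser of two continuous maps into a Hausdorff group; `[T2Space (GtLoc L v)]` is taken as an instance BINDER — no global instance for `∏_{w∣v} L_w` is registered).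
* §2 **`IsEpsCanonicalAt (L) (Φ) (v) (νGt) (mGt)`** — THE DEFINITION, the ε-twin of ★ `OrbitalMeasureFamily.IsCanonical` TOKEN FOR TOKEN: at every ε-class `c` (modulo `⊥`)
  whose representative `δ_c = out c` is ε-REGULAR (★ `IsEpsRegularAt`: `N(δ) = δ ε(δ)` regular semisimple), the member `mGt c` on `G̃_v ⧸ G̃_{δ_c ε}` IS the invariant
  quotient (★ `quotientMeasure`) of `νGt` by a Haar measure `t` on `G̃_{δ_c ε}` that is inversion invariant and normalised by `t (compactCore G̃_{δ_c ε}) = 1`; no member is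
  constrained off the ε-regular classes; + **`isEpsCanonicalAt_iff`** (`Iff.rfl`).  Argument order `(L) (Φ) (v) (νGt) (mGt)` FIXED by the dealer (sockets typed in parallel).
  The topological mixins `[LocallyCompactSpace] [SecondCountableTopology] [T2Space] (GtLoc L v)` required by ★ `quotientMeasure` are instance BINDERS (none is a registered
  instance for `GL (Fin 3) (∏_{w∣v} L_w)`; the S4 sockets discharge them at the place model as ★ `R90S4TwistedTraceTransport` does).

HONEST LABEL: count-neutral helper (a definition + topology; closes no socket by itself); HC_CM is proved only modulo the 7 printed citations (2 remaining named inputs: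
hLiu418 = stmt-HodgeConjecture-24832, h413 = stmt-HodgeConjecture-24833) until rung 0 closes.

## References
* [Rogawski1990] J. D. Rogawski, *Automorphic Representations of Unitary Groups in Three Variables*, Ann. of Math. Stud. 123 (1990), §1.4 p. 4, §1.6 pp. 5–6 (twisted orbital
  integrals, `G̃(δε)″`), §1.7 p. 6 (Haar ∕ Tamagawa measures), §4.3 (4.3.1) p. 43 (compatible measures), §4.10 (4.10.1) p. 57 (`Φ_ε^κ(δ, φ)`).
* [DeitmarEchterhoff2014] A. Deitmar, S. Echterhoff, *Principles of Harmonic Analysis*, 2nd ed. (2014), Thm. 1.5.3 (invariant quotient measures).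
* [BourbakiGT1] N. Bourbaki, *General Topology* I, Ch. III §2 (compact subgroups; closed subgroups of Hausdorff groups).
-/

set_option autoImplicit false
set_option linter.dupNamespace false   -- `Summit.HodgeConjecture.HodgeConjecture.…` (D-0017 nested layout)

noncomputable section

open MeasureTheory Topology
open scoped NumberField MatrixGroups

namespace Summit.HodgeConjecture.HodgeConjecture.R90.S4

open Literature.NumberTheory.Rogawski1990
open Literature.NumberTheory.Rogawski1990.Ch4Sec10
open Literature.NumberTheory.Automorphic
open Literature.MeasureTheory.Group
open IsDedekindDomain NumberField
open Summit.HodgeConjecture.HodgeConjecture.Cruxes.H413.K2E1GlobalTestFunctionsTwisted (twistLocal continuous_twistLocal)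

variable (L : Type) [Field L] [NumberField L] [IsCMField L] (Φ : GL (Fin 3) L)
  (v : HeightOneSpectrum (𝓞 ↥(maximalRealSubfield L)))

/-! ## §1 Topology of `ε_v` and of the ε-centralisers -/

/-- **`ε_v : G̃_v →* G̃_v` is continuous** (★ `epsLoc = twistLocal L 3 Φ c v`, ★ `continuous_twistLocal`: transpose, inverse and the entrywise CM conjugation are continuous on
`GL₃(∏_{w∣v} L_w)`). [cite: Rogawski1990, §3.11 p. 34; §4.10 p. 57] -/
theorem continuous_epsLoc : Continuous (epsLoc L Φ v) :=
  continuous_twistLocal L 3 Φ (IsCMField.complexConj L) v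

/-- **The ε-centraliser `G̃_{δε}` is closed** in `G̃_v` (for `G̃_v` Hausdorff): it is the equaliser `{g | δ⁻¹ g δ = ε_v(g)}` (★ `epsCentralizer`) of two continuous maps.
[cite: Rogawski1990, §1.4 p. 4; §1.6 p. 5] [cite: BourbakiGT1, Ch. III §2] -/
theorem isClosed_epsCentralizer [T2Space (GtLoc L v)] (δ : GtLoc L v) :
    IsClosed ((epsCentralizer (epsLoc L Φ v) δ : Subgroup (GtLoc L v)) : Set (GtLoc L v)) := by
  change IsClosed {g : GtLoc L v | (MulAut.conj δ⁻¹).toMonoidHom g = epsLoc L Φ v g}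
  exact isClosed_eq ((continuous_const.mul continuous_id).mul continuous_const) (continuous_epsLoc L Φ v)

/-! ## §2 Canonical ε-twisted orbital measure families -/

/-- **`mGt` IS CANONICAL FOR `νGt` AT `(L, Φ, v)`** — the ε-twin of ★ `OrbitalMeasureFamily.IsCanonical`, token for token: at every ε-conjugacy class `c` of `G̃_v` (modulo
`⊥`) whose representative `δ_c = out c` is ε-REGULAR (★ `IsEpsRegularAt`: the norm `N(δ_c) = δ_c ε(δ_c)` is regular semisimple), the member `mGt c` on `G̃_v ⧸ G̃_{δ_c ε}` IS
the invariant quotient measure `dνGt ∕ dt` (★ `quotientMeasure`, Deitmar–Echterhoff Thm. 1.5.3) of the Haar measure `νGt` on `G̃_v` (a PARAMETER — the kit's twisted-trace-formula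
measure; right invariant) by THE Haar measure `t` on the ε-centraliser `G̃_{δ_c ε}` which is inversion invariant and NORMALISED BY `t (compactCore G̃_{δ_c ε}) = 1`; no member is
constrained off the ε-regular classes.  Print: «The twisted orbital integrals … are defined using compatible measures» (§4.3 p. 43, §4.10 (4.10.1) p. 57); «All measures on groups
are assumed to be Haar measures» (§1.7 p. 6).  Argument order `(L) (Φ) (v) (νGt) (mGt)` is the dealer's (S4 16:34:04Z); the three topological mixins on `GtLoc L v` are binders.
[cite: Rogawski1990, §1.6 pp. 5–6; §4.3 (4.3.1) p. 43; §4.10 (4.10.1) p. 57] [cite: DeitmarEchterhoff2014, Thm. 1.5.3] -/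
def IsEpsCanonicalAt [LocallyCompactSpace (GtLoc L v)] [SecondCountableTopology (GtLoc L v)] [T2Space (GtLoc L v)]
    [MeasurableSpace (GtLoc L v)] [BorelSpace (GtLoc L v)]
    [∀ δ : GtLoc L v, MeasurableSpace (GtLoc L v ⧸ epsCentralizer (epsLoc L Φ v) δ)]
    [∀ δ : GtLoc L v, BorelSpace (GtLoc L v ⧸ epsCentralizer (epsLoc L Φ v) δ)]
    (νGt : Measure (GtLoc L v)) [IsFiniteMeasureOnCompacts νGt] [νGt.IsMulRightInvariant]
    (mGt : EpsOrbitalMeasureFamily (epsLoc L Φ v) ⊥) : Prop :=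
  ∀ c : EpsConjClassesMod (epsLoc L Φ v) ⊥, IsEpsRegularAt L Φ v (Quotient.out c) →
    ∃ t : Measure ↥(epsCentralizer (epsLoc L Φ v) (Quotient.out c)),
      ∃ (_ : t.IsHaarMeasure) (_ : t.IsInvInvariant),
        t (compactCore ↥(epsCentralizer (epsLoc L Φ v) (Quotient.out c))) = 1 ∧
          mGt c = quotientMeasure (epsCentralizer (epsLoc L Φ v) (Quotient.out c)) t
            (isClosed_epsCentralizer L Φ v (Quotient.out c)) νGt

/-- Unfolding of `IsEpsCanonicalAt`. [cite: Rogawski1990, §4.3 (4.3.1) p. 43; §4.10 (4.10.1) p. 57] -/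
theorem isEpsCanonicalAt_iff [LocallyCompactSpace (GtLoc L v)] [SecondCountableTopology (GtLoc L v)] [T2Space (GtLoc L v)]
    [MeasurableSpace (GtLoc L v)] [BorelSpace (GtLoc L v)]
    [∀ δ : GtLoc L v, MeasurableSpace (GtLoc L v ⧸ epsCentralizer (epsLoc L Φ v) δ)]
    [∀ δ : GtLoc L v, BorelSpace (GtLoc L v ⧸ epsCentralizer (epsLoc L Φ v) δ)]
    (νGt : Measure (GtLoc L v)) [IsFiniteMeasureOnCompacts νGt] [νGt.IsMulRightInvariant]
    (mGt : EpsOrbitalMeasureFamily (epsLoc L Φ v) ⊥) :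
    IsEpsCanonicalAt L Φ v νGt mGt ↔
      ∀ c : EpsConjClassesMod (epsLoc L Φ v) ⊥, IsEpsRegularAt L Φ v (Quotient.out c) →
        ∃ t : Measure ↥(epsCentralizer (epsLoc L Φ v) (Quotient.out c)),
          ∃ (_ : t.IsHaarMeasure) (_ : t.IsInvInvariant),
            t (compactCore ↥(epsCentralizer (epsLoc L Φ v) (Quotient.out c))) = 1 ∧
              mGt c = quotientMeasure (epsCentralizer (epsLoc L Φ v) (Quotient.out c)) t
                (isClosed_epsCentralizer L Φ v (Quotient.out c)) νGt :=
  Iff.rfl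

end Summit.HodgeConjecture.HodgeConjecture.R90.S4

end
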